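import Summits.ABC.StewartYu.PadicG3TwoScheduleArith
import HarnessLib

/-!
# Cell abc-stewartyu, Gen-3 frame at `p = 2` (crux `Y07Two`, stmt-ABC-19659), record: the slots of the schedule of
# record `schedTwoS` in the BUDGET UNIT `Z = G·X·L` (pre-scaled Fel'dman sizes, directional line, weights)

`Summits/ABC/StewartYu/PadicG3TwoBudgetZ.lean` — cell `abc-stewartyu` (HOME `run/shared/lean/pub/abc-stewartyu/`),
route `PadicPrimesKummerThird`, seat p3 (g6, F-two lead).  Theorems only (real arithmetic): the ledger's base facts
(`36(n+1) ≤ X`, `8(n+1) ≤ G`, products with `L`, `H`, `X·L`), `L₀·G ≤ Z/8 + G` (under `2G ≤ yload`), and the three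
slot bounds consumed by the k-step / third-step budget lines: **`log_feldSize_le_Z`** (`log feldSize ≤ (7/5)·Z + G +
13(n+1)`: `T03 0·I*·log 3 ≤ (459/576)Z`, `T03 0·log ν(H) ≤ (621/2560)Z`, the `Y₀`-line `L₀·(1 + log(1 +
3^{I*−I}r/H)) ≤ (41/128)Z + …` for `3^{I*−I}r ≤ 9·3^{I*}·3ᵏ·H`), **`mul_log_Xb3R_le_Z`** (`T·log Xb3R ≤ (5/16)Z`,
`T ≤ T03 0`), **`log_Bw3_le_Z`** (`log Bw3 ≤ (9/64)Z + G`, `G = (m+2)·log 2`).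

WHAT THIS IS NOT: the budget comparisons (sequel `PadicG3TwoBudgetK`); no crux moves.

References: Yu. V. Nesterenko, LNM 1819 (2003), §3.1 Prop 3.1, §4.2 (4.19)–(4.35); K. Yu, Acta Math. 211
(2013), §3.1, Lemma 5.2; HOME/p1/K-M3-1-padic-ledger.md §4.
-/

noncomputable section

open Finset Real
open Literature.NumberTheory.Transcendental
open Literature.NumberTheory.Transcendental.CW77.Setup (Tau tauNorm)

namespace Summit.ABC.StewartYu

namespace TwoSetup

open Summit.ABC.StewartYu.G3Boxes Summit.ABC.StewartYu.PadicG3Par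

variable (S : TwoSetup) (P : PadicG3Par (S.d + 1))

/-! ### Numeric constants -/

/-- `log 2 ≤ 7/10`. [folklore] -/
theorem log_two_le : Real.log 2 ≤ 7 / 10 := by have := Real.log_two_lt_d9; linarith

/-- `log 3 ≤ 6/5` (`log 3 = log 2 + log (3/2)`, `log(3/2) ≤ 1/2`). [folklore] -/
theorem log_three_le : Real.log 3 ≤ 6 / 5 := by
  have h : Real.log 3 = Real.log 2 + Real.log (3 / 2) := by
    rw [← Real.log_mul (by norm_num) (by norm_num)]; norm_num
  have h2 : Real.log (3 / 2 : ℝ) ≤ 3 / 2 - 1 := Real.log_le_sub_one_of_pos (by norm_num)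
  rw [h]; linarith [log_two_le]

/-- `log 10 ≤ 12/5` (`log 10 = 3 log 2 + log (5/4)`). [folklore] -/
theorem log_ten_le : Real.log 10 ≤ 12 / 5 := by
  have h : Real.log 10 = Real.log (2 ^ 3) + Real.log (5 / 4) := by
    rw [← Real.log_mul (by norm_num) (by norm_num)]; norm_num
  have h2 : Real.log (5 / 4 : ℝ) ≤ 5 / 4 - 1 := Real.log_le_sub_one_of_pos (by norm_num)
  rw [h, Real.log_pow]; push_cast; linarith [log_two_le]

/-! ### The ledger's base facts in the unit `Z = G·X·L` -/

/-- Base facts: `36(n+1) ≤ X`, `8(n+1) ≤ G`, `2^25 ≤ L`, and the products `36(n+1)·L·G ≤ Z`,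
`288(n+1)²·L ≤ Z`, `64(n+1)·L·H ≤ Z`, `8(n+1)·X·L ≤ Z`. [folklore] -/
theorem base_facts :
    36 * ((S.d : ℝ) + 1 + 1) ≤ P.X ∧ 8 * ((S.d : ℝ) + 1 + 1) ≤ P.G ∧ (2 : ℝ) ^ 25 ≤ P.L ∧
    36 * ((S.d : ℝ) + 1 + 1) * (P.L * P.G) ≤ P.G * P.X * P.L ∧
    288 * ((S.d : ℝ) + 1 + 1) ^ 2 * P.L ≤ P.G * P.X * P.L ∧
    64 * ((S.d : ℝ) + 1 + 1) * (P.L * P.H) ≤ P.G * P.X * P.L ∧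
    8 * ((S.d : ℝ) + 1 + 1) * (P.X * P.L) ≤ P.G * P.X * P.L := by
  have hX := P.X_ge; push_cast at hX
  have hn := P.n_le; push_cast at hn
  have hG : 8 * ((S.d : ℝ) + 1 + 1) ≤ P.G := by linarith
  have hL := P.two_pow_25_le_L
  have hH := P.H_le; push_cast at hH
  have hL0 : (0 : ℝ) ≤ P.L := by positivity
  have hG0 : (0 : ℝ) ≤ P.G := by linarith [P.eight_le_G]
  have hX0 : (0 : ℝ) ≤ P.X := by positivity
  have hN : (0 : ℝ) < (S.d : ℝ) + 1 + 1 := by positivity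
  refine ⟨hX, hG, hL, ?_, ?_, ?_, ?_⟩
  · have := mul_le_mul_of_nonneg_left hX (mul_nonneg hL0 hG0); nlinarith
  · have h1 : 8 * ((S.d : ℝ) + 1 + 1) * (36 * ((S.d : ℝ) + 1 + 1)) ≤ P.G * P.X :=
      mul_le_mul hG hX (by positivity) hG0
    nlinarith
  · have h1 : 64 * ((S.d : ℝ) + 1 + 1) * P.H ≤ P.G * P.X := by
      rw [le_div_iff₀ (by positivity)] at hH; linarith
    nlinarith
  · have h1 := mul_le_mul_of_nonneg_right hG (mul_nonneg hX0 hL0)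
    have e : P.G * P.X * P.L = P.G * (P.X * P.L) := by ring
    rw [e]; exact h1

/-- `L₀ ≤ Z/(8G) + 1 ≤ Z/(64(n+1)) + 1` when `2G ≤ yload`; and `L₀·G ≤ Z/8 + G`. [folklore] -/
theorem L₀_facts (hy : 2 * P.G ≤ P.yload) :
    (P.L₀ : ℝ) * P.G ≤ P.G * P.X * P.L / 8 + P.G ∧
    (P.L₀ : ℝ) * (64 * ((S.d : ℝ) + 1 + 1)) ≤ P.G * P.X * P.L + 64 * ((S.d : ℝ) + 1 + 1) := by
  obtain ⟨_, hG8, _, _, _, _, _⟩ := S.base_facts P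
  have hL₀ := P.L₀_le
  have hGpos : 0 < P.G := by linarith [P.eight_le_G]
  have hZ : 0 ≤ P.G * P.X * P.L := by have := P.GXL_ge; linarith [show (0:ℝ) ≤ 16*72*2^25 by positivity]
  have h1 : P.G * P.X * P.L / (4 * P.yload) ≤ P.G * P.X * P.L / (8 * P.G) :=
    div_le_div_of_nonneg_left hZ (by positivity) (by linarith)
  have hL₀' : (P.L₀ : ℝ) ≤ P.G * P.X * P.L / (8 * P.G) + 1 := by linarith
  constructor
  · have e : P.G * P.X * P.L / (8 * P.G) * P.G = P.G * P.X * P.L / 8 := by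
      field_simp
    calc (P.L₀ : ℝ) * P.G ≤ (P.G * P.X * P.L / (8 * P.G) + 1) * P.G := mul_le_mul_of_nonneg_right hL₀' hGpos.le
      _ = P.G * P.X * P.L / 8 + P.G := by rw [add_mul, one_mul, e]
  · have h2 : P.G * P.X * P.L / (8 * P.G) ≤ P.G * P.X * P.L / (64 * ((S.d : ℝ) + 1 + 1)) :=
      div_le_div_of_nonneg_left hZ (by positivity) (by linarith)
    have hN : (0 : ℝ) < 64 * ((S.d : ℝ) + 1 + 1) := by positivity
    have := mul_le_mul_of_nonneg_right (hL₀'.trans (by linarith : P.G * P.X * P.L / (8 * P.G) + 1 ≤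
      P.G * P.X * P.L / (64 * ((S.d : ℝ) + 1 + 1)) + 1)) hN.le
    rw [add_mul, one_mul, div_mul_cancel₀ _ hN.ne'] at this
    exact this

/-! ### The pre-scaled Fel'dman size in the unit `Z` -/

/-- **`log feldSize I r t ≤ (7/5)·Z + G + 13(n+1)`** for `I ≤ I*`, `t ≤ T03 0`, `0 ≤ r`,
`3^{I*−I}·r ≤ 9·3^{I*}·3^{k}·H` with `k ≤ d + 3`, under `G = (m+2)·log 2`, `2G ≤ yload`.
[cite: Nesterenko2003, §3.1 Prop 3.1, §4.2 (4.19)–(4.20); shape only] -/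
theorem log_feldSize_le_Z (hG : P.G = (P.m + 2) * Real.log 2) (hy : 2 * P.G ≤ P.yload)
    (I : ℕ) {r : ℝ} (hr : 0 ≤ r) {k : ℕ} (hk : k ≤ S.d + 3)
    (hre : (3 : ℝ) ^ (S.Istar3 P - I) * r ≤ 9 * (3 : ℝ) ^ S.Istar3 P * (3 : ℝ) ^ k * P.H)
    {t : ℕ} (ht : t ≤ S.T03 P 0) :
    Real.log (S.feldSize P I r t) ≤ (7 / 5) * (P.G * P.X * P.L) + P.G + 13 * ((S.d : ℝ) + 1 + 1) := by
  obtain ⟨hX36, hG8, hL25, hLG, hLL, hLH, hXL⟩ := S.base_facts P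
  obtain ⟨hL₀G, hL₀N⟩ := S.L₀_facts P hy
  set Z : ℝ := P.G * P.X * P.L with hZ
  set N1 : ℝ := (S.d : ℝ) + 1 + 1 with hN1
  have hd0 : (0 : ℝ) ≤ (S.d : ℝ) := by positivity
  have hN1' : 2 ≤ N1 := by rw [hN1]; linarith
  have hGpos : 0 < P.G := by linarith [P.eight_le_G]
  have hHpos : (0 : ℝ) < P.H := by have : 1 ≤ P.H := le_max_left _ _; exact_mod_cast this
  have hH1 : (1 : ℝ) ≤ P.H := by exact_mod_cast (show 1 ≤ P.H from le_max_left _ _)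
  have hL1 : (1 : ℝ) ≤ P.L := P.one_le_L
  have hlog2 := log_two_le
  have hlog3 := log_three_le
  have hlog10 := log_ten_le
  have hlog2pos : 0 < Real.log 2 := Real.log_pos (by norm_num)
  have hlog3pos : 0 < Real.log 3 := Real.log_pos (by norm_num)
  rw [S.log_feldSize P I hr t]
  -- (1) the start order
  have hT := S.T03_zero_le P
  have ht' : (t : ℝ) ≤ (8 * ((S.d : ℝ) + 1) + 19) * P.L := le_trans (by exact_mod_cast ht) hT
  have h819 : 8 * ((S.d : ℝ) + 1) + 19 ≤ (27 / 2) * N1 := by rw [hN1]; linarith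
  have htN : (t : ℝ) ≤ (27 / 2) * N1 * P.L := by
    have hL0 : (0 : ℝ) ≤ P.L := by positivity
    have := mul_le_mul_of_nonneg_right h819 hL0
    linarith
  -- (2) the depth
  have hIs := S.Istar3_mul_log_three_le P
  have hIs' : (S.Istar3 P : ℝ) * Real.log 3 ≤ 6 / 5 + (7 / 10) * ((S.d : ℝ) + 23) + P.G := by
    have e : ((S.d : ℝ) + 1 + 24 + P.m) * Real.log 2 = ((S.d : ℝ) + 23) * Real.log 2 + (P.m + 2) * Real.log 2 := by
      ring
    rw [e, ← hG] at hIs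
    have : ((S.d : ℝ) + 23) * Real.log 2 ≤ (7 / 10) * ((S.d : ℝ) + 23) := by
      have h0 : (0 : ℝ) ≤ (S.d : ℝ) + 23 := by positivity
      nlinarith
    linarith
  have hA : 6 / 5 + (7 / 10) * ((S.d : ℝ) + 23) ≤ 9 * N1 := by rw [hN1]; linarith
  -- (2a) `((I*−I)·t)·log 3 ≤ t·I*·log 3 ≤ (27/2)N1·L·(G + 9N1)`
  have h2a : (((S.Istar3 P - I) * t : ℕ) : ℝ) * Real.log 3 ≤ (3 / 8) * Z + (243 / 576) * Z := by
    have h1 : (((S.Istar3 P - I) * t : ℕ) : ℝ) ≤ (S.Istar3 P : ℝ) * t := by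
      have : (S.Istar3 P - I) * t ≤ S.Istar3 P * t := Nat.mul_le_mul_right _ (Nat.sub_le _ _)
      exact_mod_cast this
    have h2 : (((S.Istar3 P - I) * t : ℕ) : ℝ) * Real.log 3 ≤ (t : ℝ) * ((S.Istar3 P : ℝ) * Real.log 3) := by
      have := mul_le_mul_of_nonneg_right h1 hlog3pos.le
      have e : (S.Istar3 P : ℝ) * t * Real.log 3 = (t : ℝ) * ((S.Istar3 P : ℝ) * Real.log 3) := by ring
      linarith
    have h3 : (t : ℝ) * ((S.Istar3 P : ℝ) * Real.log 3) ≤ (27 / 2) * N1 * P.L * (P.G + 9 * N1) := by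
      have hI0 : 0 ≤ (S.Istar3 P : ℝ) * Real.log 3 := by positivity
      calc (t : ℝ) * ((S.Istar3 P : ℝ) * Real.log 3) ≤ (27 / 2) * N1 * P.L * ((S.Istar3 P : ℝ) * Real.log 3) :=
            mul_le_mul_of_nonneg_right htN hI0
        _ ≤ (27 / 2) * N1 * P.L * (P.G + 9 * N1) := by
            apply mul_le_mul_of_nonneg_left (by linarith) (by positivity)
    -- `(27/2) N1 L G ≤ (27/72) Z`, `(243/2) N1² L ≤ (243/576) Z`
    have h4 : (27 / 2) * N1 * P.L * P.G ≤ (3 / 8) * Z := by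
      have e : (27 / 2) * N1 * P.L * P.G = (27 / 72) * (36 * N1 * (P.L * P.G)) := by ring
      rw [e]; linarith
    have h5 : (27 / 2) * N1 * P.L * (9 * N1) ≤ (243 / 576) * Z := by
      have e : (27 / 2) * N1 * P.L * (9 * N1) = (243 / 576) * (288 * N1 ^ 2 * P.L) := by ring
      rw [e]; linarith
    have e6 : (27 / 2) * N1 * P.L * (P.G + 9 * N1) = (27 / 2) * N1 * P.L * P.G + (27 / 2) * N1 * P.L * (9 * N1) := by
      ring
    linarith
  -- (2b) `t·log ν(H) ≤ (27/2)N1·L·(23/20)H ≤ (621/2560) Z`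
  have h2b : (t : ℝ) * Real.log (Nat.lcmUpto P.H) ≤ (621 / 2560) * Z := by
    have hν := NWPi.log_lcmUpto_le P.H
    have hν0 : 0 ≤ Real.log (Nat.lcmUpto P.H) := Real.log_nonneg (by exact_mod_cast Nat.lcmUpto_pos P.H)
    calc (t : ℝ) * Real.log (Nat.lcmUpto P.H) ≤ (27 / 2) * N1 * P.L * (23 / 20 * (P.H : ℝ)) :=
          mul_le_mul htN hν hν0 (by positivity)
      _ = (621 / 2560) * (64 * N1 * (P.L * P.H)) := by ring
      _ ≤ (621 / 2560) * Z := by linarith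
  -- (2c) `H/e ≤ H ≤ Z/2^30`
  have h2c : (P.H : ℝ) / Real.exp 1 ≤ Z / 2 ^ 30 := by
    have he : (1 : ℝ) ≤ Real.exp 1 := Real.one_le_exp zero_le_one
    have h1 : (P.H : ℝ) / Real.exp 1 ≤ P.H := div_le_self hHpos.le he
    have h2 : (P.H : ℝ) * (64 * N1 * P.L) ≤ Z := by
      have e : (P.H : ℝ) * (64 * N1 * P.L) = 64 * N1 * (P.L * P.H) := by ring
      rw [e]; exact hLH
    have hNL : (2 : ℝ) * 2 ^ 25 ≤ N1 * P.L := mul_le_mul hN1' hL25 (by positivity) (by linarith)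
    have h3 : (2 : ℝ) ^ 30 ≤ 64 * N1 * P.L := by
      have e : (64 : ℝ) * N1 * P.L = 64 * (N1 * P.L) := by ring
      rw [e]; norm_num at hNL ⊢; linarith
    have h4 : (P.H : ℝ) * 2 ^ 30 ≤ (P.H : ℝ) * (64 * N1 * P.L) := mul_le_mul_of_nonneg_left h3 hHpos.le
    rw [le_div_iff₀ (by positivity)]
    linarith only [h1, h2, h4]
  -- (2d) the `Y₀`-line `L₀·(1 + log(1 + 3^{I*−I} r/H))`
  have h2d : (P.L₀ : ℝ) * (1 + Real.log (1 + (3 : ℝ) ^ (S.Istar3 P - I) * r / P.H)) ≤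
      (1 / 8) * Z + P.G + (25 / 128) * Z + (25 / 2) * N1 := by
    -- `1 + 3^{I*−I} r/H ≤ 10·3^{I*}·3^k`
    have hq : (3 : ℝ) ^ (S.Istar3 P - I) * r / P.H ≤ 9 * (3 : ℝ) ^ S.Istar3 P * (3 : ℝ) ^ k := by
      rw [div_le_iff₀ hHpos]; linarith
    have hone : (1 : ℝ) ≤ (3 : ℝ) ^ S.Istar3 P * (3 : ℝ) ^ k := one_le_mul_of_one_le_of_one_le
      (one_le_pow₀ (by norm_num)) (one_le_pow₀ (by norm_num))
    have hpos : 0 < 1 + (3 : ℝ) ^ (S.Istar3 P - I) * r / P.H := by positivity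
    have hlog : Real.log (1 + (3 : ℝ) ^ (S.Istar3 P - I) * r / P.H) ≤
        Real.log 10 + (S.Istar3 P : ℝ) * Real.log 3 + k * Real.log 3 := by
      have h1 : 1 + (3 : ℝ) ^ (S.Istar3 P - I) * r / P.H ≤ 10 * ((3 : ℝ) ^ S.Istar3 P * (3 : ℝ) ^ k) := by
        linarith
      have h2 := Real.log_le_log hpos h1
      rw [Real.log_mul (by norm_num) (by positivity), Real.log_mul (by positivity) (by positivity),
        Real.log_pow, Real.log_pow] at h2
      linarith
    have hk' : (k : ℝ) * Real.log 3 ≤ (N1 + 1) * (6 / 5) := by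
      have hk1 : (k : ℝ) ≤ N1 + 1 := by
        rw [hN1]; exact_mod_cast (by omega : k ≤ S.d + 1 + 1 + 1)
      exact mul_le_mul hk1 hlog3 hlog3pos.le (by positivity)
    -- `1 + log(...) ≤ G + (12/5 + 1 + 9 N1 + (6/5)(N1+1)) ≤ G + (25/2) N1`
    have hbr : 1 + Real.log (1 + (3 : ℝ) ^ (S.Istar3 P - I) * r / P.H) ≤ P.G + (25 / 2) * N1 := by
      linarith
    have hL₀0 : (0 : ℝ) ≤ P.L₀ := by positivity
    calc (P.L₀ : ℝ) * (1 + Real.log (1 + (3 : ℝ) ^ (S.Istar3 P - I) * r / P.H))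
        ≤ (P.L₀ : ℝ) * (P.G + (25 / 2) * N1) := mul_le_mul_of_nonneg_left hbr hL₀0
      _ = (P.L₀ : ℝ) * P.G + (25 / 128) * ((P.L₀ : ℝ) * (64 * N1)) := by ring
      _ ≤ (Z / 8 + P.G) + (25 / 128) * (Z + 64 * N1) := by
          have := mul_le_mul_of_nonneg_left hL₀N (by norm_num : (0:ℝ) ≤ 25 / 128)
          linarith
      _ = (1 / 8) * Z + P.G + (25 / 128) * Z + (25 / 2) * N1 := by ring
  -- total: 3/8 + 243/576 + 621/2560 + 2^{-30} + 1/8 + 25/128 ≤ 7/5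
  have hZ0 : 0 ≤ Z := by rw [hZ]; have := P.GXL_ge; linarith [show (0:ℝ) ≤ 16*72*2^25 by positivity]
  linarith only [h2a, h2b, h2c, h2d, hZ0, hN1']

/-! ### The directional line and the weights -/

/-- **`T·log Xb3R I ≤ (5/16)·Z`** for `T ≤ T03 0`. [cite: Nesterenko2003, §4.2 (4.23); shape only] -/
theorem mul_log_Xb3R_le_Z (hA1 : ∀ j, 1 ≤ P.A j) (hb : ∀ j, |(S.b j : ℝ)| ≤ Real.exp P.W)
    (hbθ : |(S.bθ : ℝ)| ≤ Real.exp P.W) (I : ℕ) {T : ℝ} (hT : T ≤ S.T03 P 0) :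
    T * Real.log (S.Xb3R P I : ℝ) ≤ (5 / 16) * (P.G * P.X * P.L) := by
  obtain ⟨hX36, hG8, hL25, hLG, hLL, hLH, hXL⟩ := S.base_facts P
  set Z : ℝ := P.G * P.X * P.L with hZ
  set N1 : ℝ := (S.d : ℝ) + 1 + 1 with hN1
  have hd0 : (0 : ℝ) ≤ (S.d : ℝ) := by positivity
  have hN1' : 2 ≤ N1 := by rw [hN1]; linarith
  have hXb := S.log_Xb3R_le P I hA1 hb hbθ
  have hWL := P.WL_mul_le; push_cast at hWL
  have hTT := S.T03_zero_le P
  have h819 : 8 * ((S.d : ℝ) + 1) + 19 ≤ (27 / 2) * N1 := by rw [hN1]; linarith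
  have hL0 : (0 : ℝ) ≤ P.L := by positivity
  have hTN : T ≤ (27 / 2) * N1 * P.L := by
    have := mul_le_mul_of_nonneg_right h819 hL0
    linarith
  have hXb0 : 0 ≤ Real.log (S.Xb3R P I : ℝ) :=
    Real.log_nonneg (by exact_mod_cast S.one_le_Xb3R P I)
  -- `log(2n) − 1 ≤ 2 N1` and `WL ≥ 1`
  have hlogn : Real.log (2 * ((S.d : ℝ) + 1)) ≤ 2 * ((S.d : ℝ) + 1) - 1 :=
    Real.log_le_sub_one_of_pos (by positivity)
  have hWL1 := P.WL_ge_one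
  have hbd : Real.log (S.Xb3R P I : ℝ) ≤ P.WL + 2 * N1 := by rw [hN1]; linarith
  calc T * Real.log (S.Xb3R P I : ℝ) ≤ (27 / 2) * N1 * P.L * (P.WL + 2 * N1) :=
        mul_le_mul hTN hbd hXb0 (by positivity)
    _ = (27 / 2) * (N1 * P.L * P.WL) + 27 * (N1 ^ 2 * P.L) := by ring
    _ ≤ (27 / 2) * (Z / 64) + 27 * (Z / 288) := by
        have h1 : N1 * P.L * P.WL ≤ Z / 64 := by rw [hZ]; rw [hN1]; linarith
        have h2 : N1 ^ 2 * P.L ≤ Z / 288 := by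
          rw [le_div_iff₀ (by norm_num)]; linarith
        linarith
    _ ≤ (5 / 16) * Z := by
        have hZ0 : 0 ≤ Z := by rw [hZ]; have := P.GXL_ge; linarith [show (0:ℝ) ≤ 16*72*2^25 by positivity]
        linarith

/-- **`log Bw3 ≤ (9/64)·Z + G`** under `G = (m+2)·log 2`, `2G ≤ yload`. [folklore] -/
theorem log_Bw3_le_Z (hG : P.G = (P.m + 2) * Real.log 2) (hy : 2 * P.G ≤ P.yload) :
    Real.log (S.Bw3 P) ≤ (9 / 64) * (P.G * P.X * P.L) + P.G := by
  obtain ⟨hX36, hG8, hL25, hLG, hLL, hLH, hXL⟩ := S.base_facts P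
  obtain ⟨hL₀G, hL₀N⟩ := S.L₀_facts P hy
  set Z : ℝ := P.G * P.X * P.L with hZ
  set N1 : ℝ := (S.d : ℝ) + 1 + 1 with hN1
  have hd0 : (0 : ℝ) ≤ (S.d : ℝ) := by positivity
  have hN1' : 2 ≤ N1 := by rw [hN1]; linarith
  have h := S.log_Bw3_le P
  have e : (P.L₀ : ℝ) * ((P.m + 3) * Real.log 2) = (P.L₀ : ℝ) * P.G + (P.L₀ : ℝ) * Real.log 2 := by
    rw [hG]; ring
  rw [e] at h
  have hL₀0 : (0 : ℝ) ≤ P.L₀ := by positivity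
  have h2 : (P.L₀ : ℝ) * Real.log 2 ≤ (P.L₀ : ℝ) * (64 * N1) / 128 := by
    have := log_two_le; nlinarith
  have hZ0 : 0 ≤ Z := by rw [hZ]; have := P.GXL_ge; linarith [show (0:ℝ) ≤ 16*72*2^25 by positivity]
  have h3 : (P.L₀ : ℝ) * (64 * N1) / 128 ≤ Z / 128 + N1 / 2 := by
    have := hL₀N; rw [div_le_iff₀ (by norm_num)]; linarith
  have hN1Z : N1 ≤ Z / 2 ^ 30 := by
    have hNL : (2 : ℝ) * 2 ^ 25 ≤ N1 * P.L := mul_le_mul hN1' hL25 (by positivity) (by linarith)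
    have h30 : (2 : ℝ) ^ 30 ≤ 288 * N1 * P.L := by
      have e : (288 : ℝ) * N1 * P.L = 288 * (N1 * P.L) := by ring
      rw [e]; norm_num at hNL ⊢; linarith
    have h31 : N1 * 2 ^ 30 ≤ N1 * (288 * N1 * P.L) := mul_le_mul_of_nonneg_left h30 (by linarith)
    have e : N1 * (288 * N1 * P.L) = 288 * N1 ^ 2 * P.L := by ring
    rw [le_div_iff₀ (by positivity)]; linarith
  linarith

end TwoSetup

end Summit.ABC.StewartYu

end
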